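import Summits.Ventures.HSemireg.EmbeddedFirstOrderDeformations
import Summits.Ventures.HSemireg.ObstructionLocusLocalBranches
import HarnessLib

/-!
# Venture HSemireg — embedded first-order deformations of the SR design `W ⊂ 𝔸ⁿ` are tuples of branch classes
# (composition: Hartshorne Prop. 2.3 ∘ LEMMA L1 (i))

HONEST FRAMING.  Part of the Lean side of the computation cell `pub-hsemireg` (track «S4-PUSH» (ii)); a one-line
composition of two landed files, offered by seat s4-prove-2 (bus l.11200) and filed by seat s4-prove-3:
`EmbeddedDeformation.equiv` (s4-prove-3: flat embedded first-order deformations of `V(I) ⊂ Spec R` inside `Spec R[ε]`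
↔ `Hom_R(I, R/I)`, Hartshorne *Deformation Theory* Prop. 2.3) composed with `ObstructionLocus.normalModuleEquiv`
(s4-prove-2, LEMMA L1 (i) of general-structure/eng1/g2/G2-REDUCIBLE-POINT-THEOREM.md §2:
`Hom_R(I_W, R/I_W) ≃ Π_k Π_{j ≠ k} R/(x_j, x_k)`, «restrict the normal field to the branch»), for the ideal
`I_W = (m_1, …, m_n)`, `m_k = ∏_{l ≠ k} x_l`, of the SR design in `R = K[x_1, …, x_n]`, `K` a domain:

* `srDesignEquiv K n : {J // IsEmbeddedDeformation (srDesignIdeal K n) J} ≃ Π_k Π_{j ≠ k} R/(x_j, x_k)` — «every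
  embedded first-order deformation of `W` inside the trivial ambient deformation IS a tuple of branch classes».

Nothing else; the (H-arr) binder's remaining paper parts (Čech gluing over a non-trivial `A_ξ`, the branch-following
criterion) are untouched.  No scheme, sheaf or abelian variety is constructed; nothing here says that HC, HC_CM or
HC_AV holds.
-/

open DualNumber

namespace Summit.Ventures.HSemireg

namespace EmbeddedDeformation

open ObstructionLocus MvPolynomial

/-- **Embedded first-order deformations of the SR design are tuples of branch classes** (Hartshorne Prop. 2.3 ∘ L1 (i)):
for a domain `K` and `R = K[x_1, …, x_n]`, the flat lifts of `I_W` to `R[ε]` correspond bijectively to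
`Π_k Π_{j ≠ k} R/(x_j, x_k)` — a class on each branch `B_jk` for each generator `m_k`. -/
noncomputable def srDesignEquiv (K : Type*) [CommRing K] [IsDomain K] (n : ℕ) :
    {J : Ideal (MvPolynomial (Fin n) K)[ε] // IsEmbeddedDeformation (srDesignIdeal K n) J} ≃
      ((k : Fin n) → (j : {j : Fin n // j ≠ k}) →
        MvPolynomial (Fin n) K ⧸ Ideal.span {(X j.1 : MvPolynomial (Fin n) K), X k}) :=
  (equiv (srDesignIdeal K n)).trans (normalModuleEquiv K n).toEquiv

/-- The trivial deformation `I_W·R[ε]` corresponds to the zero tuple. -/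
theorem srDesignEquiv_trivial (K : Type*) [CommRing K] [IsDomain K] (n : ℕ) :
    srDesignEquiv K n ⟨(srDesignIdeal K n).map (algebraMap _ _), isEmbeddedDeformation_map _⟩ = 0 := by
  simp [srDesignEquiv, equiv, normalVector_map]

end EmbeddedDeformation

end Summit.Ventures.HSemireg
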